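import Summits.ResolutionOfSingularities.ResolutionOfSingularities.Theorems.UniformComplexityCampaignW82AlgClosedKernel
import Summits.ResolutionOfSingularities.ResolutionOfSingularities.Theorems.UniversalCellsCampaignW82FamilyTransferGradedProofs
import Summits.ResolutionOfSingularities.ResolutionOfSingularities.Theorems.UniversalCellsCampaignW82ClimbKernelRungs
import HarnessLib

/-!
# Slot W8.2, door 2: the graded kernel at ALGEBRAICALLY CLOSED constant fields reduces to the
# perfection step, and its LOW RUNGS (`n ≤ 1` unconditional, `n ≤ 3` from `CossartPiltant2019`)

Theses-free module (imports the OURS vocabulary `…CampaignW82AlgClosedKernel` (p470934, typer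
res-L1-type-o6), res-L1-s82-pv-1's proofs `…FamilyTransferGradedProofs` (p475166:
`familyTransferSucc_holds`, `spreadOutRatFuncDimLe_top_top`, the perfect-`M` rungs) and
`…ClimbKernelRungs` (p469530)).

Door 2 of the W8.2 lever (`UniformComplexity.PrimeModelTransfer`, stmt-ResolutionOfSingularities-8933)
needs the transfer kernel only at algebraically closed constant fields `M` (p470915 / p475050). With
the finite-level family transfer now PROVED for every constant field (p475166), the door-2 graded
kernel `ClimbRatFuncPerfAlgClosedDimLe p m n` reduces to the door-2 PERFECTION STEP
`PerfectionStepAlgClosedDimLe p n` (resolution over `M(t)` in dimension `≤ n` ⇒ resolution over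
`M(t)^{perf}` in dimension `≤ n`, `M` algebraically closed):

* `climbRatFuncPerfAlgClosedDimLe_of_perfectionStepAlgClosed` — `PerfectionStepAlgClosedDimLe p n →
  ClimbRatFuncPerfAlgClosedDimLe p m n` for every `m ≥ n + 1`; `…_succ_…` the case `m = n + 1`;
* `climbRatFuncPerfAlgClosed_of_perfectionStepAlgClosed_top` — `PerfectionStepAlgClosedDimLe p ⊤ →
  ClimbRatFuncPerfAlgClosed p` (the ungraded door-2 kernel hangs on the perfection step ONLY);
* low rungs, hypotheses idle: `perfectionStepAlgClosedDimLe_of_le_one` /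
  `climbRatFuncPerfAlgClosedDimLe_of_le_one` UNCONDITIONAL (curves: `hasResolution_of_dim_le_one`
  through p475166 / p469530), `perfectionStepAlgClosedDimLe_of_le_three` /
  `climbRatFuncPerfAlgClosedDimLe_of_le_three` CONDITIONAL on the named fact
  `Literature.AlgebraicGeometry.Resolution.CossartPiltant2019` (F-02, taken as a hypothesis exactly as
  in p469530 / p475166);
* `climbRatFuncPerfAlgClosedDimLe_five_four_of_perfectionStepAlgClosed_four` — the first open rung
  of door 2 is `PerfectionStepAlgClosedDimLe p 4` (fibre dimension 4 over `𝔽̄_p(t)^{perf}`).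

The leaf `Theorems/UniformComplexityPrimeModelTransferOfPerfectionStepAlgClosed.lean` concludes
`PrimeModelTransfer` BY NAME from `∀ p prime, PerfectionStepAlgClosedDimLe p ⊤`.

[OURS · LADDER-RESOLUTION L1, slot W8.2 (prime-field / universality transfer), door 2
UniformComplexity] Pure-logic rungs of OURS statements over the summit's own routes; NOT statements
of, and attributing nothing to, Hironaka's 2017 manuscript. [cite: CossartPiltant2019, Thm. 1.1]
-/

noncomputable section

set_option linter.dupNamespace false -- mandated namespace of this single-conjunct summit

open CategoryTheory CategoryTheory.Limits AlgebraicGeometry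
open Literature.AlgebraicGeometry.Resolution

namespace Summit.ResolutionOfSingularities.ResolutionOfSingularities.Theorems.CampaignW82

/-! ## Door 2's graded kernel reduces to the door-2 perfection step -/

/-- **The door-2 graded kernel at `(n + 1, n)` IS the door-2 perfection step at grade `n`** (the
finite level `SpreadOutRatFuncDimLe p (n + 1) n` being the theorem `familyTransferSucc_holds`,
p475166). [folklore] -/
theorem climbRatFuncPerfAlgClosedDimLe_succ_of_perfectionStepAlgClosed {p : ℕ} {n : WithBot ℕ∞}
    (h : PerfectionStepAlgClosedDimLe p n) : ClimbRatFuncPerfAlgClosedDimLe p (n + 1) n :=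
  climbRatFuncPerfAlgClosedDimLe_of_spreadOut_of_perfectionStepAlgClosed (familyTransferSucc_holds p n) h

/-- `PerfectionStepAlgClosedDimLe p n → ClimbRatFuncPerfAlgClosedDimLe p m n` for every `m ≥ n + 1`
(e.g. `m = ⊤`). [folklore] -/
theorem climbRatFuncPerfAlgClosedDimLe_of_perfectionStepAlgClosed {p : ℕ} {m n : WithBot ℕ∞}
    (hm : n + 1 ≤ m) (h : PerfectionStepAlgClosedDimLe p n) : ClimbRatFuncPerfAlgClosedDimLe p m n :=
  climbRatFuncPerfAlgClosedDimLe_of_spreadOut_of_perfectionStepAlgClosed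
    (spreadOutRatFuncDimLe_of_add_one_le p hm) h

/-- **The ungraded door-2 kernel from the door-2 perfection step at grade `⊤` alone**:
`PerfectionStepAlgClosedDimLe p ⊤ → ClimbRatFuncPerfAlgClosed p` (`spreadOutRatFuncDimLe_top_top`,
p475166; `climbRatFuncPerfAlgClosed_iff_top`, p470934). [folklore] -/
theorem climbRatFuncPerfAlgClosed_of_perfectionStepAlgClosed_top {p : ℕ}
    (h : PerfectionStepAlgClosedDimLe p ⊤) : ClimbRatFuncPerfAlgClosed p :=
  (climbRatFuncPerfAlgClosed_iff_top p).2
    (climbRatFuncPerfAlgClosedDimLe_of_spreadOut_of_perfectionStepAlgClosed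
      (spreadOutRatFuncDimLe_top_top p) h)

/-- **First open rung of door 2**: the door-2 kernel grade `(5, 4)` is exactly
`PerfectionStepAlgClosedDimLe p 4`. [folklore] -/
theorem climbRatFuncPerfAlgClosedDimLe_five_four_of_perfectionStepAlgClosed_four {p : ℕ}
    (h : PerfectionStepAlgClosedDimLe p 4) : ClimbRatFuncPerfAlgClosedDimLe p 5 4 :=
  climbRatFuncPerfAlgClosedDimLe_of_perfectionStepAlgClosed (by decide) h

/-! ## `n ≤ 1`: unconditional -/

/-- **The door-2 perfection step in fibre dimension `≤ 1` holds outright** (hypothesis idle;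
`perfectionStepDimLe_of_le_one`, p475166, restricted to algebraically closed `M`). [folklore] -/
theorem perfectionStepAlgClosedDimLe_of_le_one (p : ℕ) {n : WithBot ℕ∞} (hn : n ≤ 1) :
    PerfectionStepAlgClosedDimLe p n :=
  perfectionStepAlgClosedDimLe_of_perfectionStepDimLe (perfectionStepDimLe_of_le_one p hn)

/-- **The door-2 graded kernel at `(m, n)` with `n ≤ 1` holds outright**
(`climbRatFuncPerfDimLe_of_le_one`, p469530, restricted to algebraically closed `M`). [folklore] -/
theorem climbRatFuncPerfAlgClosedDimLe_of_le_one (p : ℕ) (m : WithBot ℕ∞) {n : WithBot ℕ∞}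
    (hn : n ≤ 1) : ClimbRatFuncPerfAlgClosedDimLe p m n :=
  climbRatFuncPerfAlgClosedDimLe_of_climbRatFuncPerfDimLe (climbRatFuncPerfDimLe_of_le_one p m n hn)

/-! ## `n ≤ 3`: conditional on the named fact `CossartPiltant2019` -/

/-- **The door-2 perfection step in fibre dimension `≤ 3`, from `CossartPiltant2019`** (taken as a
hypothesis; `perfectionStepDimLe_of_le_three`, p475166, restricted to algebraically closed `M`).
[cite: CossartPiltant2019, Thm. 1.1] -/
theorem perfectionStepAlgClosedDimLe_of_le_three (hCP : CossartPiltant2019.{0}) (p : ℕ)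
    {n : WithBot ℕ∞} (hn : n ≤ 3) : PerfectionStepAlgClosedDimLe p n :=
  perfectionStepAlgClosedDimLe_of_perfectionStepDimLe (perfectionStepDimLe_of_le_three hCP p hn)

/-- **The door-2 graded kernel at `(m, n)` with `n ≤ 3`, from `CossartPiltant2019`**
(`climbRatFuncPerfDimLe_of_le_three`, p469530, restricted to algebraically closed `M`).
[cite: CossartPiltant2019, Thm. 1.1] -/
theorem climbRatFuncPerfAlgClosedDimLe_of_le_three (hCP : CossartPiltant2019.{0}) (p : ℕ)
    (m : WithBot ℕ∞) {n : WithBot ℕ∞} (hn : n ≤ 3) : ClimbRatFuncPerfAlgClosedDimLe p m n :=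
  climbRatFuncPerfAlgClosedDimLe_of_climbRatFuncPerfDimLe
    (climbRatFuncPerfDimLe_of_le_three hCP p m n hn)

end Summit.ResolutionOfSingularities.ResolutionOfSingularities.Theorems.CampaignW82

end
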